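import Mathlib
import Summits.ValiantsHypothesis.ValiantsHypothesis.Theorems.BarrierLeverPartitionMinorsHitByVPHiddenStatesFullJoinCut

/-!
# Route BarrierLever — item `PartitionMinorsHitByVP` (stmt-ValiantsHypothesis-19717), line `hidden_states`:
# THE EQUAL-LINK STEP FOR CONJECTURE FJ AT NODE LEVEL — one more state buys one equal-link cut

Helper file (`--supports stmt-ValiantsHypothesis-19717`; cell valiant-natproofs, rung V4, 𝒟-side door (c), line
`Cruxes/PartitionMinorsHitByVP/Lines/hidden_states.lean` v8; prover seat val-np-p3 gen 16). Definition-free. Closes NO item.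

THE POINT (memo val-np-p3 g16 «full join» §4.3(a), §8(b); kernel cut p674990 `FullJoin.det_fullJoin_cut_ne_zero`). The conjecture
`FullJoin.Stmt.fullJoinCubePairLower` (p672719) asks, for a pair `(u, w)`, for `K` states, tables `tx ty : Option (Fin K) → Fin h → ℂ` and
weights `λ` with `det[Σ_{J ⊆ Fin K} λ^J ∏_{a∈u i}(…) ∏_{c∈w j}(…)] ≠ 0`. THIS FILE: if the rows of `u` split at a coordinate `a` into
deletion/link and the columns of `w` split at `b` with THE SAME SIZES (`rD`, `rL`; `eRow`, `eCol`, `π` as in the cut file), and the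
deletion pair and the link pair have nonsingular full hidden sums with `K` states AT ONE COMMON TABLE, then `(u, w)` has a nonsingular
full hidden sum with `K + 1` states (`fullJoinCube_step`): the common table is extended by a NEW state `Fin.last K` tied exclusively to
`a` and `b` (`extendTable`-free: the extension is written inline with `Fin.lastCases`), coordinate `a` (resp. `b`) is silenced in the old
table (harmless: the deletion and link families avoid it), the sum over `Finset (Fin (K+1))` is the sum over `insert (last K) (univ.map castSucc)`
(`sum_transfer`), and the cut lemma applies with `λ_last = 1`. This is the inductive step that, together with the star leaves and the
diagonal/isomorphic base (p673836/p674147), proves FJ on the class PEEL⁺ of the memo (76 % of lower class pairs at h = 5) once a peeling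
is exhibited; the common-table hypothesis is dischargeable by genericity (product of two nonzero determinant polynomials; not done here).

WHAT THIS IS NOT: no pair is certified here beyond the hypotheses; item 19717 stays OPEN; nothing on crux 14610 or VP ≠ VNP.
-/

set_option linter.dupNamespace false

namespace Summit.ValiantsHypothesis.ValiantsHypothesis.Theorems.BarrierLever.HiddenStates

open Finset Matrix

noncomputable section

namespace FullJoin

variable {h K : ℕ}

/-- **Transfer of a full-join entry along `castSucc`.** Extend a `K`-state table by a new state `Fin.last K` (acting by `new`) and
silence a coordinate `a` in the old part (`tx'` below). For a set `U` avoiding `a`, the `x`-factor over `J₀.map castSucc` computed with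
the extended table equals the old `x`-factor over `J₀`. -/
theorem xFactor_transfer (tx : Option (Fin K) → Fin h → ℂ) (a : Fin h) (new : Fin h → ℂ)
    (U : Finset (Fin h)) (haU : a ∉ U) (J₀ : Finset (Fin K)) :
    (∏ a' ∈ U, ((fun (o : Option (Fin (K + 1))) (x : Fin h) =>
        (o.elim (if x = a then 0 else tx none x)
          (fun q => Fin.lastCases (new x) (fun q₀ => if x = a then 0 else tx (some q₀) x) q) : ℂ)) none a' +
        ∑ q ∈ J₀.map Fin.castSuccEmb, (fun (o : Option (Fin (K + 1))) (x : Fin h) =>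
          (o.elim (if x = a then 0 else tx none x)
            (fun q => Fin.lastCases (new x) (fun q₀ => if x = a then 0 else tx (some q₀) x) q) : ℂ)) (some q) a')) =
      ∏ a' ∈ U, (tx none a' + ∑ q ∈ J₀, tx (some q) a') := by
  refine Finset.prod_congr rfl fun a' ha' => ?_
  have hne : a' ≠ a := fun h' => haU (h' ▸ ha')
  simp only [Option.elim, if_neg hne, Finset.sum_map, Fin.castSuccEmb_apply, Fin.lastCases_castSucc]

/-- **Transfer of the whole full hidden sum.** With the extended tables (new state `last K` acting by `newx` on the `x`-side and `newy`
on the `y`-side, coordinates `a`, `b` silenced in the old parts) and weights `Fin.lastCases c lam`, the full hidden sum over the state set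
`univ.map castSucc` at `(U, W)` with `a ∉ U`, `b ∉ W` is the old full hidden sum over all of `Finset (Fin K)`. -/
theorem sum_transfer (tx ty : Option (Fin K) → Fin h → ℂ) (lam : Fin K → ℂ) (a b : Fin h) (newx newy : Fin h → ℂ) (c : ℂ)
    (U W : Finset (Fin h)) (haU : a ∉ U) (hbW : b ∉ W) :
    (∑ J ∈ ((Finset.univ : Finset (Fin K)).map Fin.castSuccEmb).powerset,
        (∏ q ∈ J, (Fin.lastCases c lam q : ℂ)) *
        ((∏ a' ∈ U, ((fun (o : Option (Fin (K + 1))) (x : Fin h) =>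
            (o.elim (if x = a then 0 else tx none x)
              (fun q => Fin.lastCases (newx x) (fun q₀ => if x = a then 0 else tx (some q₀) x) q) : ℂ)) none a' +
            ∑ q ∈ J, (fun (o : Option (Fin (K + 1))) (x : Fin h) =>
              (o.elim (if x = a then 0 else tx none x)
                (fun q => Fin.lastCases (newx x) (fun q₀ => if x = a then 0 else tx (some q₀) x) q) : ℂ)) (some q) a')) *
          ∏ c' ∈ W, ((fun (o : Option (Fin (K + 1))) (x : Fin h) =>
            (o.elim (if x = b then 0 else ty none x)
              (fun q => Fin.lastCases (newy x) (fun q₀ => if x = b then 0 else ty (some q₀) x) q) : ℂ)) none c' +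
            ∑ q ∈ J, (fun (o : Option (Fin (K + 1))) (x : Fin h) =>
              (o.elim (if x = b then 0 else ty none x)
                (fun q => Fin.lastCases (newy x) (fun q₀ => if x = b then 0 else ty (some q₀) x) q) : ℂ)) (some q) c'))) =
      ∑ J₀ : Finset (Fin K), (∏ q ∈ J₀, lam q) *
        ((∏ a' ∈ U, (tx none a' + ∑ q ∈ J₀, tx (some q) a')) * ∏ c' ∈ W, (ty none c' + ∑ q ∈ J₀, ty (some q) c')) := by
  classical
  -- the powerset of the image is the image of the powerset
  have hpow : ((Finset.univ : Finset (Fin K)).map Fin.castSuccEmb).powerset =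
      (Finset.univ : Finset (Fin K)).powerset.image (fun J₀ => J₀.map Fin.castSuccEmb) := by
    rw [Finset.map_eq_image, Finset.powerset_image]
    refine Finset.image_congr fun J₀ _ => ?_
    rw [Finset.map_eq_image]
  rw [hpow, Finset.sum_image (fun J₀ _ J₁ _ hJ => Finset.map_injective Fin.castSuccEmb hJ), Finset.powerset_univ]
  refine Finset.sum_congr rfl fun J₀ _ => ?_
  rw [xFactor_transfer tx a newx U haU J₀, xFactor_transfer ty b newy W hbW J₀, Finset.prod_map]
  simp only [Fin.castSuccEmb_apply, Fin.lastCases_castSucc]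

variable {r rD rL : ℕ}

/-- **THE EQUAL-LINK STEP for conjecture FJ (node level).** Let the rows of `u` split at the coordinate `a` into deletion rows
(`a ∉ u`, indexed by `Fin rD` through `eRow ∘ inl`) and link rows (`a ∈ u`, through `eRow ∘ inr`), the columns of `w` at `b` likewise
through `eCol` with THE SAME sizes, and let every link row `ℓ` have the deletion partner `π ℓ` carrying `u ∖ a`. If ONE common `K`-state
table makes both the deletion pair `(u∘eRow∘inl, w∘eCol∘inl)` and the link pair `((u∘eRow∘inr) ∖ a, (w∘eCol∘inr) ∖ b)` have nonsingular
full hidden sums, then `(u, w)` has a nonsingular full hidden sum with `K + 1` states. -/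
theorem fullJoinCube_step (u w : Fin r → Finset (Fin h)) (a b : Fin h)
    (eRow eCol : Fin rD ⊕ Fin rL ≃ Fin r)
    (hDrow : ∀ i, a ∉ u (eRow (Sum.inl i))) (hLrow : ∀ ℓ, a ∈ u (eRow (Sum.inr ℓ)))
    (hDcol : ∀ j, b ∉ w (eCol (Sum.inl j))) (hLcol : ∀ ℓ, b ∈ w (eCol (Sum.inr ℓ)))
    (π : Fin rL → Fin rD) (hπ : ∀ ℓ, u (eRow (Sum.inl (π ℓ))) = (u (eRow (Sum.inr ℓ))).erase a)
    (H : ∃ (tx ty : Option (Fin K) → Fin h → ℂ) (lam : Fin K → ℂ),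
      (Matrix.of fun i j : Fin rD => ∑ J : Finset (Fin K), (∏ q ∈ J, lam q) *
          ((∏ a' ∈ u (eRow (Sum.inl i)), (tx none a' + ∑ q ∈ J, tx (some q) a')) *
            ∏ c ∈ w (eCol (Sum.inl j)), (ty none c + ∑ q ∈ J, ty (some q) c))).det ≠ 0 ∧
      (Matrix.of fun ℓ ℓ' : Fin rL => ∑ J : Finset (Fin K), (∏ q ∈ J, lam q) *
          ((∏ a' ∈ (u (eRow (Sum.inr ℓ))).erase a, (tx none a' + ∑ q ∈ J, tx (some q) a')) *
            ∏ c ∈ (w (eCol (Sum.inr ℓ'))).erase b, (ty none c + ∑ q ∈ J, ty (some q) c))).det ≠ 0) :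
    ∃ (tx' ty' : Option (Fin (K + 1)) → Fin h → ℂ) (lam' : Fin (K + 1) → ℂ),
      (Matrix.of fun i j : Fin r => ∑ J : Finset (Fin (K + 1)), (∏ q ∈ J, lam' q) *
        ((∏ a' ∈ u i, (tx' none a' + ∑ q ∈ J, tx' (some q) a')) *
          ∏ c ∈ w j, (ty' none c + ∑ q ∈ J, ty' (some q) c))).det ≠ 0 := by
  classical
  obtain ⟨tx, ty, lam, hD, hL⟩ := H
  -- the extended tables: new state `last K` acts by the indicator of `a` (resp. `b`); old states silenced at `a` (resp. `b`)
  let tx' : Option (Fin (K + 1)) → Fin h → ℂ := fun o x =>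
    o.elim (if x = a then 0 else tx none x)
      (fun q => Fin.lastCases (if x = a then 1 else 0) (fun q₀ => if x = a then 0 else tx (some q₀) x) q)
  let ty' : Option (Fin (K + 1)) → Fin h → ℂ := fun o x =>
    o.elim (if x = b then 0 else ty none x)
      (fun q => Fin.lastCases (if x = b then 1 else 0) (fun q₀ => if x = b then 0 else ty (some q₀) x) q)
  let lam' : Fin (K + 1) → ℂ := Fin.lastCases 1 lam
  refine ⟨tx', ty', lam', ?_⟩
  -- the state set: `univ = insert (last K) (univ.map castSucc)`
  set S' : Finset (Fin (K + 1)) := (Finset.univ : Finset (Fin K)).map Fin.castSuccEmb with hS'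
  have hlast : Fin.last K ∉ S' := by
    rw [hS']
    simp [Finset.mem_map]
  have huniv : (Finset.univ : Finset (Finset (Fin (K + 1)))) = (insert (Fin.last K) S').powerset := by
    rw [← Finset.powerset_univ, Fin.univ_castSuccEmb, Finset.cons_eq_insert]
  -- exclusivity of the new state
  have hxa0 : tx' none a = 0 := by simp [tx']
  have hxk : tx' (some (Fin.last K)) a = 1 := by simp [tx', Fin.lastCases_last]
  have hxq : ∀ q, q ≠ Fin.last K → tx' (some q) a = 0 := by
    intro q hq
    obtain ⟨q₀, rfl⟩ := Fin.eq_castSucc_of_ne_last hq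
    simp [tx', Fin.lastCases_castSucc]
  have hxk' : ∀ a', a' ≠ a → tx' (some (Fin.last K)) a' = 0 := by
    intro a' ha'
    simp [tx', Fin.lastCases_last, ha']
  have hyb0 : ty' none b = 0 := by simp [ty']
  have hyk : ty' (some (Fin.last K)) b = 1 := by simp [ty', Fin.lastCases_last]
  have hyq : ∀ q, q ≠ Fin.last K → ty' (some q) b = 0 := by
    intro q hq
    obtain ⟨q₀, rfl⟩ := Fin.eq_castSucc_of_ne_last hq
    simp [ty', Fin.lastCases_castSucc]
  have hyk' : ∀ b', b' ≠ b → ty' (some (Fin.last K)) b' = 0 := by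
    intro b' hb'
    simp [ty', Fin.lastCases_last, hb']
  have hlam0 : lam' (Fin.last K) ≠ 0 := by simp [lam', Fin.lastCases_last]
  have hlam1 : 1 + lam' (Fin.last K) ≠ 0 := by
    simp only [lam', Fin.lastCases_last]
    norm_num
  -- rewrite the sum over all state sets as the sum over the powerset of `insert (last K) S'`
  have hmat : (Matrix.of fun i j : Fin r => ∑ J : Finset (Fin (K + 1)), (∏ q ∈ J, lam' q) *
        ((∏ a' ∈ u i, (tx' none a' + ∑ q ∈ J, tx' (some q) a')) *
          ∏ c ∈ w j, (ty' none c + ∑ q ∈ J, ty' (some q) c))) =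
      Matrix.of fun i j : Fin r => ∑ J ∈ (insert (Fin.last K) S').powerset, (∏ q ∈ J, lam' q) *
        ((∏ a' ∈ u i, (tx' none a' + ∑ q ∈ J, tx' (some q) a')) *
          ∏ c ∈ w j, (ty' none c + ∑ q ∈ J, ty' (some q) c)) := by
    refine Matrix.ext fun i j => ?_
    rw [Matrix.of_apply, Matrix.of_apply, ← huniv]
  rw [hmat]
  refine det_fullJoin_cut_ne_zero S' (Fin.last K) hlast a b u w tx' ty' lam' hxa0 hxk hxq hxk' hyb0 hyk hyq hyk'
    eRow eCol hDrow hLrow hDcol hLcol π hπ hlam0 hlam1 ?_ ?_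
  · -- deletion block = the old deletion full join
    have hblk : (Matrix.of fun i j : Fin rD => ∑ J ∈ S'.powerset, (∏ q ∈ J, lam' q) *
          ((∏ a' ∈ u (eRow (Sum.inl i)), (tx' none a' + ∑ q ∈ J, tx' (some q) a')) *
            ∏ c ∈ w (eCol (Sum.inl j)), (ty' none c + ∑ q ∈ J, ty' (some q) c))) =
        Matrix.of fun i j : Fin rD => ∑ J : Finset (Fin K), (∏ q ∈ J, lam q) *
          ((∏ a' ∈ u (eRow (Sum.inl i)), (tx none a' + ∑ q ∈ J, tx (some q) a')) *
            ∏ c ∈ w (eCol (Sum.inl j)), (ty none c + ∑ q ∈ J, ty (some q) c)) := by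
      refine Matrix.ext fun i j => ?_
      rw [Matrix.of_apply, Matrix.of_apply, hS']
      exact sum_transfer tx ty lam a b (fun x => if x = a then 1 else 0) (fun x => if x = b then 1 else 0) 1
        _ _ (hDrow i) (hDcol j)
    rw [hblk]
    exact hD
  · -- link block = the old link full join
    have hblk : (Matrix.of fun ℓ ℓ' : Fin rL => ∑ J ∈ S'.powerset, (∏ q ∈ J, lam' q) *
          ((∏ a' ∈ (u (eRow (Sum.inr ℓ))).erase a, (tx' none a' + ∑ q ∈ J, tx' (some q) a')) *
            ∏ c ∈ (w (eCol (Sum.inr ℓ'))).erase b, (ty' none c + ∑ q ∈ J, ty' (some q) c))) =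
        Matrix.of fun ℓ ℓ' : Fin rL => ∑ J : Finset (Fin K), (∏ q ∈ J, lam q) *
          ((∏ a' ∈ (u (eRow (Sum.inr ℓ))).erase a, (tx none a' + ∑ q ∈ J, tx (some q) a')) *
            ∏ c ∈ (w (eCol (Sum.inr ℓ'))).erase b, (ty none c + ∑ q ∈ J, ty (some q) c)) := by
      refine Matrix.ext fun ℓ ℓ' => ?_
      rw [Matrix.of_apply, Matrix.of_apply, hS']
      exact sum_transfer tx ty lam a b (fun x => if x = a then 1 else 0) (fun x => if x = b then 1 else 0) 1
        _ _ (Finset.notMem_erase a _) (Finset.notMem_erase b _)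
    rw [hblk]
    exact hL

end FullJoin

end

end Summit.ValiantsHypothesis.ValiantsHypothesis.Theorems.BarrierLever.HiddenStates
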